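import Summits.Ventures.LatticeQCDFlow.Scoring.SU2TorusPlaquetteFiniteVolume
import Summits.Ventures.LatticeQCDFlow.Scoring.OnePlaquetteEnclosures
import Summits.Ventures.LatticeQCDFlow.Scoring.OnePlaquetteBessel
import HarnessLib

/-!
# SU(2) on the 2-torus: an elementary explicit finite-volume bound, and kernel-checked enclosures of the exact `16²` / `8²` torus plaquettes

HONEST FRAMING: exact (Metropolis-corrected) sampling algorithms for lattice gauge theory;
figures of merit are autocorrelation/cost numbers at stated couplings and volumes; no
continuum-physics claim.

Venture `LatticeQCDFlow` (cell pub-lqcd), sub-topic `Scoring`; FANOUT row 5 (`s0-sun-a`), GEN-10.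
NEW WORK of the cell (placement rule); the SU(2) analogue of GEN-8's kernel-checked U(1) torus
enclosures (`U1TorusPlaquetteEnclosures`).  From `SU2TorusPlaquetteFiniteVolume` and the termwise
Bessel ratio bound `I_{n+1}(x) ≤ x/(2(n+1))·I_n(x)` (`Literature/…/BesselIIntegralSeries`):

* `tsum_besselI_add_two_le` — `Σ_n I_{n+2}(x) ≤ (e^{x/2} − 1)·I₁(x)` (`x ≥ 0`);
* **`abs_wilson_mean_su2a0_plaquette_two_sub_le_explicit`** — for `β > 0` and every `L ≥ 1`:
  `|⟨½ tr U_p⟩_{(ℤ/L)²,β} − I₂(2β)/I₁(2β)| ≤ (¼ + (5/2)(e^β − 1))·(β/2)^{L²−1}` — ELEMENTARY and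
  explicit (no series left);
* **`wilson_mean_su2a0_plaquette_encl_16_2p2`** etc. — at the cell's SU(2) reference couplings
  `b = 2β ∈ {1.8, 2.2, 2.7}` (theory-2's `β ∈ {9/10, 11/10, 27/20}`), the exact `16 × 16` (and `8 × 8`)
  torus plaquettes lie within `10⁻³⁰` (`16²`; `10⁻¹⁴` at `8²`) of GEN-5's width-`10⁻¹²` kernel
  enclosures of `I₂(b)/I₁(b)`: e.g. `0.464479025270 − 10⁻³⁰ ≤ ⟨½ tr U_p⟩_{16²,b=2.2} ≤ 0.464479025271 + 10⁻³⁰`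
  — the row's S0-C-02 point, now a kernel-checked statement about theory-2's Wilson measure
  (`decide +kernel` for GEN-5's rational certificate, `norm_num` for the powers).

Elementary; nothing is cited; no `def`.
-/

noncomputable section

open Real MeasureTheory Set Function Finset Polynomial.Chebyshev
open Literature.MathematicalPhysics.QuantumFieldTheory Literature.MathematicalPhysics.QuantumLattice
open Literature.Analysis.FunctionSpaces
open Summit.Ventures.LatticeQCDFlow.Exactness
open Summit.Ventures.LatticeQCDFlow.Theory2.Lattice

namespace Summit.Ventures.LatticeQCDFlow.Scoring

/-! ## §1. `Σ_n I_{n+2}(x) ≤ (e^{x/2} − 1)·I₁(x)` -/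

/-- Iterated termwise ratio bound: `I_{k+1}(x) ≤ (x/2)^k/k!·I₁(x)` (`x ≥ 0`). -/
theorem besselI_succ_le_pow_div_factorial_mul_besselI_one (k : ℕ) {x : ℝ} (hx : 0 ≤ x) :
    besselI (k + 1) x ≤ (x / 2) ^ k / (Nat.factorial k) * besselI 1 x := by
  induction k with
  | zero => simp
  | succ k ih =>
    have h1 := besselI_succ_le_div_mul (k + 1) hx
    have hI := besselI_nonneg 1 hx
    have hfac : (0 : ℝ) < Nat.factorial k := by exact_mod_cast Nat.factorial_pos k
    calc besselI (k + 1 + 1) x ≤ x / (2 * ((k + 1 : ℕ) + 1)) * besselI (k + 1) x := h1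
      _ ≤ x / (2 * ((k + 1 : ℕ) + 1)) * ((x / 2) ^ k / (Nat.factorial k) * besselI 1 x) :=
          mul_le_mul_of_nonneg_left ih (by positivity)
      _ ≤ (x / 2) ^ (k + 1) / (Nat.factorial (k + 1)) * besselI 1 x := by
          rw [Nat.factorial_succ]
          push_cast
          have hk2 : (0 : ℝ) < (k : ℝ) + 1 + 1 := by positivity
          rw [div_mul_eq_mul_div, pow_succ]
          apply le_of_sub_nonneg
          have : (x / 2) ^ (k + 1) / (((k : ℝ) + 1) * (Nat.factorial k)) * besselI 1 x -
              x * ((x / 2) ^ k / (Nat.factorial k) * besselI 1 x) / (2 * ((k : ℝ) + 1 + 1)) =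
              (x / 2) ^ k * (x / 2) * besselI 1 x / (Nat.factorial k) *
                (1 / ((k : ℝ) + 1) - 1 / ((k : ℝ) + 1 + 1)) := by
            field_simp
            ring
          rw [pow_succ] at this
          rw [this]
          have hdiff : 0 ≤ 1 / ((k : ℝ) + 1) - 1 / ((k : ℝ) + 1 + 1) := by
            rw [sub_nonneg]
            exact one_div_le_one_div_of_le (by positivity) (by linarith)
          positivity

/-- **`Σ_n I_{n+2}(x) ≤ (e^{x/2} − 1)·I₁(x)`** for `x ≥ 0`, and the series converges. -/
theorem tsum_besselI_add_two_le {x : ℝ} (hx : 0 ≤ x) :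
    (Summable fun n : ℕ => besselI (n + 2) x) ∧
      ∑' n : ℕ, besselI (n + 2) x ≤ (Real.exp (x / 2) - 1) * besselI 1 x := by
  -- the exponential series without its constant term
  have hexp : HasSum (fun n : ℕ => (x / 2) ^ n / (Nat.factorial n)) (Real.exp (x / 2)) := by
    rw [congr_fun Real.exp_eq_exp_ℝ (x / 2)]
    exact NormedSpace.expSeries_div_hasSum_exp (x / 2)
  have hexp1 : HasSum (fun n : ℕ => (x / 2) ^ (n + 1) / (Nat.factorial (n + 1))) (Real.exp (x / 2) - 1) := by
    have h := (hasSum_nat_add_iff' 1).mpr hexp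
    simpa using h
  have hbound : ∀ n : ℕ, besselI (n + 2) x ≤ (x / 2) ^ (n + 1) / (Nat.factorial (n + 1)) * besselI 1 x :=
    fun n => besselI_succ_le_pow_div_factorial_mul_besselI_one (n + 1) hx
  have hnn : ∀ n : ℕ, 0 ≤ besselI (n + 2) x := fun n => besselI_nonneg _ hx
  have hs : Summable fun n : ℕ => (x / 2) ^ (n + 1) / (Nat.factorial (n + 1)) * besselI 1 x :=
    hexp1.summable.mul_right _
  refine ⟨Summable.of_nonneg_of_le hnn hbound hs, ?_⟩
  calc ∑' n : ℕ, besselI (n + 2) x ≤ ∑' n : ℕ, (x / 2) ^ (n + 1) / (Nat.factorial (n + 1)) * besselI 1 x :=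
        (Summable.of_nonneg_of_le hnn hbound hs).tsum_le_tsum hbound hs
    _ = (Real.exp (x / 2) - 1) * besselI 1 x := by rw [tsum_mul_right, hexp1.tsum_eq]

/-! ## §2. The explicit finite-volume bound -/

/-- **EXPLICIT FINITE-VOLUME BOUND FOR THE SU(2) TORUS PLAQUETTE.**  For `β > 0`, every `L ≥ 1` and
plaquette `x₀` of `(ℤ/L)²`:
`|⟨½ tr U_{x₀}⟩_{(ℤ/L)²,β} − I₂(2β)/I₁(2β)| ≤ (¼ + (5/2)(e^β − 1))·(β/2)^{L²−1}`
(`I₂(2β)/I₁(2β) ≤ β/2` and `Σ_n I_{n+2}(2β)/I₁(2β) ≤ e^β − 1` in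
`abs_wilson_mean_su2a0_plaquette_two_sub_le`). -/
theorem abs_wilson_mean_su2a0_plaquette_two_sub_le_explicit {L : ℕ} [NeZero L] {β : ℝ} (hβ : 0 < β)
    (x₀ : Site 2 L) :
    |∫ V, su2a0 (plaquetteHolonomy V x₀ 0 1) ∂(wilsonMeasure (d := 2) (L := L) (fundamentalRep (Fin 2)) β) -
        besselI 2 (2 * β) / besselI 1 (2 * β)| ≤
      (1 / 4 + 5 / 2 * (Real.exp β - 1)) * (β / 2) ^ (L ^ 2 - 1) := by
  have h := abs_wilson_mean_su2a0_plaquette_two_sub_le hβ x₀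
  have hx : (0 : ℝ) ≤ 2 * β := by linarith
  have hI1 : 0 < besselI 1 (2 * β) := besselI_pos 1 (by linarith)
  -- `I₂/I₁ ≤ β/2`
  have hr : besselI 2 (2 * β) / besselI 1 (2 * β) ≤ β / 2 := by
    rw [div_le_iff₀ hI1]
    have := besselI_succ_le_div_mul 1 hx
    calc besselI 2 (2 * β) ≤ 2 * β / (2 * ((1 : ℕ) + 1)) * besselI 1 (2 * β) := this
      _ = β / 2 * besselI 1 (2 * β) := by push_cast; ring
  have hr0 : 0 ≤ besselI 2 (2 * β) / besselI 1 (2 * β) :=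
    div_nonneg (besselI_nonneg 2 hx) hI1.le
  -- `Σ I_{n+2}/I₁ ≤ e^β − 1`
  obtain ⟨_, hS⟩ := tsum_besselI_add_two_le hx
  have hS' : (∑' n : ℕ, besselI (n + 2) (2 * β)) / besselI 1 (2 * β) ≤ Real.exp β - 1 := by
    rw [div_le_iff₀ hI1, show 2 * β / 2 = β by ring] at *
    exact hS
  have hK : 1 / 4 + 5 / 2 * (∑' n : ℕ, besselI (n + 2) (2 * β)) / besselI 1 (2 * β) ≤
      1 / 4 + 5 / 2 * (Real.exp β - 1) := by
    rw [mul_div_assoc]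
    linarith
  have hK0 : 0 ≤ 1 / 4 + 5 / 2 * (∑' n : ℕ, besselI (n + 2) (2 * β)) / besselI 1 (2 * β) := by
    have : 0 ≤ (∑' n : ℕ, besselI (n + 2) (2 * β)) := tsum_nonneg fun n => besselI_nonneg _ hx
    positivity
  calc _ ≤ _ := h
    _ ≤ (β / 2) ^ (L ^ 2 - 1) * (1 / 4 + 5 / 2 * (Real.exp β - 1)) :=
        mul_le_mul (pow_le_pow_left₀ hr0 hr _) hK hK0 (by positivity)
    _ = _ := mul_comm _ _

/-! ## §3. Kernel-checked enclosures of the exact torus plaquettes at the reference couplings -/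

/-- A crude numerical bound: `e^β − 1 ≤ 7` for `β ≤ 2` (`e^β ≤ e² = e·e < 2.72² < 7.4`). -/
theorem exp_sub_one_le_of_le {β : ℝ} (hβ : β ≤ 2) : Real.exp β - 1 ≤ 7 := by
  have h1 : Real.exp β ≤ Real.exp 2 := Real.exp_le_exp.mpr hβ
  have h2 : Real.exp 2 = Real.exp 1 * Real.exp 1 := by rw [← Real.exp_add]; norm_num
  have h3 := Real.exp_one_lt_d9
  have h4 := Real.exp_pos 1
  nlinarith

/-- The explicit bound at a coupling `β ≤ 2`: `|⟨·⟩_L − I₂/I₁| ≤ 18·(β/2)^{L²−1}`. -/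
theorem abs_wilson_mean_su2a0_plaquette_two_sub_le_of_le_two {L : ℕ} [NeZero L] {β : ℝ} (hβ : 0 < β)
    (hβ2 : β ≤ 2) (x₀ : Site 2 L) :
    |∫ V, su2a0 (plaquetteHolonomy V x₀ 0 1) ∂(wilsonMeasure (d := 2) (L := L) (fundamentalRep (Fin 2)) β) -
        besselI 2 (2 * β) / besselI 1 (2 * β)| ≤ 18 * (β / 2) ^ (L ^ 2 - 1) := by
  refine (abs_wilson_mean_su2a0_plaquette_two_sub_le_explicit hβ x₀).trans ?_
  refine mul_le_mul_of_nonneg_right ?_ (by positivity)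
  have := exp_sub_one_le_of_le hβ2
  linarith

/-- **The exact SU(2) `16 × 16` torus plaquette at `b = 2β = 2.2` (row 5's S0-C-02 point),
kernel-enclosed**: `0.464479025270 − 10⁻³⁰ ≤ ⟨½ tr U_p⟩ ≤ 0.464479025271 + 10⁻³⁰`
(GEN-5's enclosure of `I₂(2.2)/I₁(2.2)` and the finite-volume bound `18·(11/20)^{255} < 10⁻³⁰`). -/
theorem wilson_mean_su2a0_plaquette_encl_16_2p2 (x₀ : Site 2 16) :
    (464479025270 : ℝ) / 1000000000000 - 1 / 10 ^ 30 ≤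
        ∫ V, su2a0 (plaquetteHolonomy V x₀ 0 1)
          ∂(wilsonMeasure (d := 2) (L := 16) (fundamentalRep (Fin 2)) (11 / 10)) ∧
      ∫ V, su2a0 (plaquetteHolonomy V x₀ 0 1)
          ∂(wilsonMeasure (d := 2) (L := 16) (fundamentalRep (Fin 2)) (11 / 10)) ≤
        (464479025271 : ℝ) / 1000000000000 + 1 / 10 ^ 30 := by
  have h := abs_wilson_mean_su2a0_plaquette_two_sub_le_of_le_two (L := 16) (β := 11 / 10)
    (by norm_num) (by norm_num) x₀
  have hb : (2 : ℝ) * (11 / 10) = 11 / 5 := by norm_num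
  rw [hb, ← onePlaquetteExpectSU2_cos_eq_besselI_div] at h
  have he := onePlaquetteExpectSU2_cos_encl_2p2
  have hpow : (18 : ℝ) * (11 / 10 / 2) ^ (16 ^ 2 - 1) ≤ 1 / 10 ^ 30 := by norm_num
  rw [abs_le] at h
  constructor <;> linarith [h.1, h.2, he.1, he.2]

/-- **The exact SU(2) `16 × 16` torus plaquette at `b = 2β = 1.8`, kernel-enclosed**:
`0.399372380059 − 10⁻³⁰ ≤ ⟨½ tr U_p⟩ ≤ 0.399372380060 + 10⁻³⁰`. -/
theorem wilson_mean_su2a0_plaquette_encl_16_1p8 (x₀ : Site 2 16) :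
    (399372380059 : ℝ) / 1000000000000 - 1 / 10 ^ 30 ≤
        ∫ V, su2a0 (plaquetteHolonomy V x₀ 0 1)
          ∂(wilsonMeasure (d := 2) (L := 16) (fundamentalRep (Fin 2)) (9 / 10)) ∧
      ∫ V, su2a0 (plaquetteHolonomy V x₀ 0 1)
          ∂(wilsonMeasure (d := 2) (L := 16) (fundamentalRep (Fin 2)) (9 / 10)) ≤
        (399372380060 : ℝ) / 1000000000000 + 1 / 10 ^ 30 := by
  have h := abs_wilson_mean_su2a0_plaquette_two_sub_le_of_le_two (L := 16) (β := 9 / 10)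
    (by norm_num) (by norm_num) x₀
  have hb : (2 : ℝ) * (9 / 10) = 9 / 5 := by norm_num
  rw [hb, ← onePlaquetteExpectSU2_cos_eq_besselI_div] at h
  have he := onePlaquetteExpectSU2_cos_encl_1p8
  have hpow : (18 : ℝ) * (9 / 10 / 2) ^ (16 ^ 2 - 1) ≤ 1 / 10 ^ 30 := by norm_num
  rw [abs_le] at h
  constructor <;> linarith [h.1, h.2, he.1, he.2]

/-- **The exact SU(2) `16 × 16` torus plaquette at `b = 2β = 2.7`, kernel-enclosed**:
`0.532970733589 − 10⁻³⁰ ≤ ⟨½ tr U_p⟩ ≤ 0.532970733590 + 10⁻³⁰`. -/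
theorem wilson_mean_su2a0_plaquette_encl_16_2p7 (x₀ : Site 2 16) :
    (532970733589 : ℝ) / 1000000000000 - 1 / 10 ^ 30 ≤
        ∫ V, su2a0 (plaquetteHolonomy V x₀ 0 1)
          ∂(wilsonMeasure (d := 2) (L := 16) (fundamentalRep (Fin 2)) (27 / 20)) ∧
      ∫ V, su2a0 (plaquetteHolonomy V x₀ 0 1)
          ∂(wilsonMeasure (d := 2) (L := 16) (fundamentalRep (Fin 2)) (27 / 20)) ≤
        (532970733590 : ℝ) / 1000000000000 + 1 / 10 ^ 30 := by
  have h := abs_wilson_mean_su2a0_plaquette_two_sub_le_of_le_two (L := 16) (β := 27 / 20)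
    (by norm_num) (by norm_num) x₀
  have hb : (2 : ℝ) * (27 / 20) = 27 / 10 := by norm_num
  rw [hb, ← onePlaquetteExpectSU2_cos_eq_besselI_div] at h
  have he := onePlaquetteExpectSU2_cos_encl_2p7
  have hpow : (18 : ℝ) * (27 / 20 / 2) ^ (16 ^ 2 - 1) ≤ 1 / 10 ^ 30 := by norm_num
  rw [abs_le] at h
  constructor <;> linarith [h.1, h.2, he.1, he.2]

/-- **The exact SU(2) `8 × 8` torus plaquette at `b = 2β = 2.2`, kernel-enclosed to `10⁻¹²+10⁻¹⁴`**:
`0.464479025270 − 10⁻¹⁴ ≤ ⟨½ tr U_p⟩ ≤ 0.464479025271 + 10⁻¹⁴` (`18·(11/20)^{63} < 10⁻¹⁴`; the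
transfer-lattice stage of the S0-C protocol). -/
theorem wilson_mean_su2a0_plaquette_encl_8_2p2 (x₀ : Site 2 8) :
    (464479025270 : ℝ) / 1000000000000 - 1 / 10 ^ 14 ≤
        ∫ V, su2a0 (plaquetteHolonomy V x₀ 0 1)
          ∂(wilsonMeasure (d := 2) (L := 8) (fundamentalRep (Fin 2)) (11 / 10)) ∧
      ∫ V, su2a0 (plaquetteHolonomy V x₀ 0 1)
          ∂(wilsonMeasure (d := 2) (L := 8) (fundamentalRep (Fin 2)) (11 / 10)) ≤
        (464479025271 : ℝ) / 1000000000000 + 1 / 10 ^ 14 := by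
  have h := abs_wilson_mean_su2a0_plaquette_two_sub_le_of_le_two (L := 8) (β := 11 / 10)
    (by norm_num) (by norm_num) x₀
  have hb : (2 : ℝ) * (11 / 10) = 11 / 5 := by norm_num
  rw [hb, ← onePlaquetteExpectSU2_cos_eq_besselI_div] at h
  have he := onePlaquetteExpectSU2_cos_encl_2p2
  have hpow : (18 : ℝ) * (11 / 10 / 2) ^ (8 ^ 2 - 1) ≤ 1 / 10 ^ 14 := by norm_num
  rw [abs_le] at h
  constructor <;> linarith [h.1, h.2, he.1, he.2]

end Summit.Ventures.LatticeQCDFlow.Scoring
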